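import Summits.BirchSwinnertonDyer.BirchSwinnertonDyer.Theorems.ManinLocalTwoThreeNeronSqueezeSixtyFour
import Summits.BirchSwinnertonDyer.BirchSwinnertonDyer.Theorems.ManinLocalTwoThreeNewformPinningSixtyFour
import HarnessLib

/-!
# `|c| = 1` on `X₀(64)` — UNCONDITIONALLY: the first genus-THREE level of the crux C2 `ManinOddAtFour`

Cell bsd-f2-manin, route `ManinLocalTwoThree` (crux C2 `ManinOddAtFour`, stmt-22967: `2² ∣ 64`), prover seat p3 gen 23; the capstone of
the level-`64` chain `EulerRemaindersSixtyFour → EtaLimitsSixtyFour → EtaIdentitiesSixtyFour → NeronSqueezeSixtyFour` (analytic side: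
(I1)₆₄ `y² = X³ − 4X` by weight zero, (I2)₆₄, (S2)₆₄ `Λ(φ₆₄) ⊆ Λ(16, 0)` = Néron lattice of `64a1 = y² = x³ − 4x`, Néron squeeze)
and `NewformSixtyFour → NewformPinningSixtyFour` (newform side, p2 g26's level-`48` architecture at `64`: `U₂φ₆₄ = 0`, trace to `32`
kills `φ₆₄` by Dedekind's `η` functional equation, `dim S₂(Γ₀(64)) = 3`, old `⊇ ⟨φ₃₂, φ₃₂(2τ)⟩`, old ⊓ new = 0 ⟹ new `= ℂφ₆₄` ⟹
`D.f = φ₆₄` for every `X₀(64)`-datum).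

**`abs_maninConstant_eq_one_sixtyFour`: for every globally minimal elliptic `W/ℚ` and every `X₀(64)`-parametrisation datum `D` of `W`
with the lattice clause, `|D.maninConstant| = 1`**, hence `2 ∤ c` (`not_two_dvd_maninConstant_sixtyFour`) — the body of C2 at `N = 64`
with NONE of the item's four hypotheses (no Mazur, Abbes–Ullmo, Česnavičius, modularity, CDT).

HONEST FRAMING: unconditional (standard axioms) re-assembly of landed theorems.  The `∀ N` crux C2, Manin's conjecture and BSD are NOT
proved; items 22967/22968 stay OPEN as filed.  No definition, no named fact, no sorry. [cite: AgasheRibetStein2006, §§1–2] [cite: MartinOno1997, Thm. 2]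
-/

set_option autoImplicit false
-- lint-debt: the directory name repeats the summit name (sibling precedent `ManinLocalTwoThreeNeronSqueezeSixtyFour.lean`)
set_option linter.dupNamespace false

noncomputable section

open scoped MatrixGroups ModularForm
open CongruenceSubgroup WeierstrassCurve
open Literature.NumberTheory.EllipticCurves Literature.NumberTheory.EllipticCurves.ModularForms

namespace Summit.BirchSwinnertonDyer.BirchSwinnertonDyer.Theorems.ManinLocalTwoThree.ManinConstantSixtyFour

open EtaIdentitiesSixtyFour NeronSqueezeSixtyFour NewformSixtyFour

/-- **`|c| = 1` on `X₀(64)`, UNCONDITIONALLY**: for every globally minimal elliptic `W/ℚ` and every `X₀(64)`-parametrisation datum `D`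
of `W` with the lattice clause `Λ_W = c·Λ(D.f)`.  (`D.f = φ₆₄` by the fact-free pinning, then the Néron squeeze with `64a1`.)
[cite: AgasheRibetStein2006, §§1–2] -/
theorem abs_maninConstant_eq_one_sixtyFour (W : WeierstrassCurve ℚ) [W.IsElliptic] [W.IsGloballyMinimal]
    (D : ModularParametrizationData W 64)
    (hopt : ∀ z ∈ D.L.lattice, ∃ w ∈ periodLattice D.f, z = D.c * w) :
    |D.maninConstant| = 1 :=
  abs_maninConstant_eq_one_sixtyFour_of_f_eq W D
    (f_eq_phi64 _ (coe_etaQuotientCuspForm 64 _ 2 even_two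
      NewformSixtyFour.newmanCond_phi64' NewformSixtyFour.etaCert_sixtyFour.2.2.2.2) D) hopt

/-- **`2 ∤ c` on `X₀(64)`, UNCONDITIONALLY** — the body of the crux C2 `ManinOddAtFour` at the genus-`3` level `N = 64` (`2² ∣ 64`)
with none of its four fact hypotheses. [cite: AgasheRibetStein2006, §§1–2] -/
theorem not_two_dvd_maninConstant_sixtyFour (W : WeierstrassCurve ℚ) [W.IsElliptic] [W.IsGloballyMinimal]
    (D : ModularParametrizationData W 64)
    (hopt : ∀ z ∈ D.L.lattice, ∃ w ∈ periodLattice D.f, z = D.c * w) :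
    ¬ (2 : ℤ) ∣ D.maninConstant :=
  not_two_dvd_maninConstant_sixtyFour_of_f_eq W D
    (f_eq_phi64 _ (coe_etaQuotientCuspForm 64 _ 2 even_two
      NewformSixtyFour.newmanCond_phi64' NewformSixtyFour.etaCert_sixtyFour.2.2.2.2) D) hopt

/-- **C2's body at `N = 64` in the item's literal shape**: `2² ∣ 64 → 2 ∤ c(D)` for every datum with the lattice clause, and the
`X₀(64)`-domain is inhabited GIVEN the item's own binder `exists_isNewformOf`. [cite: AgasheRibetStein2006, §§1–2] -/
theorem maninOddAtFour_sixtyFour (hnf : exists_isNewformOf) :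
    (∃ (W₀ : WeierstrassCurve ℚ) (_ : W₀.IsElliptic) (_ : W₀.IsGloballyMinimal) (D₀ : ModularParametrizationData W₀ 64),
        (∀ z ∈ D₀.L.lattice, ∃ w ∈ periodLattice D₀.f, z = D₀.c * w) ∧ |D₀.maninConstant| = 1) ∧
      ∀ (W : WeierstrassCurve ℚ) [W.IsElliptic] [W.IsGloballyMinimal] (D : ModularParametrizationData W 64),
        (∀ z ∈ D.L.lattice, ∃ w ∈ periodLattice D.f, z = D.c * w) → 2 ^ 2 ∣ 64 → ¬ (2 : ℤ) ∣ D.maninConstant := by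
  refine ⟨?_, fun W _ _ D hopt _ ↦ not_two_dvd_maninConstant_sixtyFour W D hopt⟩
  obtain ⟨W₀, h₀, hmin, D₀, -, hopt, -⟩ := maninOddAtFour_domain_inhabited_sixtyFour_of_modularity hnf
  haveI := h₀
  haveI := hmin
  exact ⟨W₀, h₀, hmin, D₀, hopt, abs_maninConstant_eq_one_sixtyFour W₀ D₀ hopt⟩

end Summit.BirchSwinnertonDyer.BirchSwinnertonDyer.Theorems.ManinLocalTwoThree.ManinConstantSixtyFour

end
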